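import Literature.Geometry.Lorentzian.CoordTensorWaveOp
import Literature.Geometry.Lorentzian.CoordGaussianSlice
import Literature.Analysis.PDE.QuasilinearHyperbolicUniqueness
import Mathlib.Analysis.InnerProductSpace.Calculus
import HarnessLib

/-!
# Uniqueness near a slice point for linear tensor wave equations `□T = L · T`

Coordinate tensor calculus on `ℝ × ℝᵈ` (`VarWave.Pt d`), metric components `G` smooth and
nondegenerate on an open set (`IsMetricOn`), components taken in the adapted basis
`(e_T, e_1, …, e_d)` (`waveBasis d` = `GaussSlice.sliceBasis` of the standard basis). If a smooth
tensor field `T` of any rank solves on the open set a linear equation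

  `(□T)_I = Σ_J L_{IJ} T_J`  (`□ = tlap`, the rough d'Alembertian; `L` smooth),

and its Cauchy data vanish on the slice `{t = 0}` near `x₁` (`T = ∂_t T = 0` there), and the
operator is hyperbolic at `(0, x₁)` with respect to the slices (`g⁰⁰ < 0`, `(gⁱʲ) > 0`), then
**`T = 0` near `(0, x₁)`** (`IsMetricOn.eventually_eq_zero_of_tlap_eq`). This is the classical
uniqueness theorem for linear diagonal second-order hyperbolic systems (Hawking–Ellis 1973, §7.4,
Prop. 7.4.5; John 1982, Ch. 5 §3), obtained here from the tree's germ uniqueness theorem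
`Literature.Analysis.PDE.VarWave.eventually_eq_of_quasilinear_germ` applied to the
`ℝ^κ`-valued function of all components (`vecField`), the zero solution, and the coordinate form
`□ = Σ g^{jk} ∂_j ∂_k + (lower order)` of `CoordTensorWaveOp.lean`. It is the uniqueness step of the
proof that Killing initial data develop into Killing fields (the wave equation `□A = −(X + Xᵗ)·A`
for the Killing defect, `CoordDeformationWave.lean`, with the vanishing Cauchy data of
`CoordKillingCauchyData.lean`). Everything is proved; the definitions are abbreviations.

## References

* S. W. Hawking, G. F. R. Ellis, *The large scale structure of space-time*, CUP 1973, §7.4,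
  Prop. 7.4.5. [HawkingEllis1973CUP]
* F. John, *Partial differential equations*, 4th ed., Springer 1982, Ch. 5 §3. [John1982]
* A. E. Fischer, J. E. Marsden, V. Moncrief, Ann. Inst. H. Poincaré A 33 (1980), Lemma 2.2.
  [FischerMarsdenMoncrief1980]
-/

noncomputable section

open Set Filter ContinuousLinearMap Module Function Metric
open scoped Topology ContDiff RealInnerProductSpace

namespace Literature.Geometry.Lorentzian

namespace MetricCoord

open Literature.Analysis.PDE Literature.Analysis.PDE.VarWave GaussSlice

variable {d : ℕ}

/-! ### The adapted basis of `ℝ × ℝᵈ` -/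

/-- The standard basis of `ℝᵈ`. [folklore] -/
abbrev stdBasis (d : ℕ) : Basis (Fin d) ℝ (EuclideanSpace ℝ (Fin d)) :=
  (EuclideanSpace.basisFun (Fin d) ℝ).toBasis

/-- **The wave basis** `(e_T, e_1, …, e_d)` of `ℝ × ℝᵈ`, indexed by `Option (Fin d)`. [folklore] -/
abbrev waveBasis (d : ℕ) : Basis (Option (Fin d)) ℝ (Pt d) :=
  sliceBasis (stdBasis d)

/-- `e_none = e_T`. [folklore] -/
@[simp] theorem waveBasis_none : waveBasis d none = eT := by
  rw [waveBasis, sliceBasis_none]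

/-- `e_{some i} = e_i`. [folklore] -/
@[simp] theorem waveBasis_some (i : Fin d) : waveBasis d (some i) = eX i := by
  rw [waveBasis, sliceBasis_some]
  simp [svec, eX]

/-! ### The vector of all components of a tensor field and its derivatives -/

section VecField

variable {κ : Type*} [Fintype κ]

/-- `ℝ^κ` as a Euclidean space: the packaging isomorphism. [folklore] -/
abbrev toEuc (κ : Type*) [Fintype κ] : (κ → ℝ) ≃L[ℝ] EuclideanSpace ℝ κ :=
  (EuclideanSpace.equiv κ ℝ).symm

omit [Fintype κ] in
/-- Components of `toEuc κ f`. [folklore] -/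
@[simp] theorem toEuc_apply [Fintype κ] (f : κ → ℝ) (K : κ) : toEuc κ f K = f K := rfl

/-- **The `ℝ^κ`-valued field of all components** of `S : P → κ → ℝ`. [folklore] -/
def vecField {P : Type*} (S : P → κ → ℝ) : P → EuclideanSpace ℝ κ := fun p ↦ toEuc κ (S p)

/-- Components of `vecField S`. [folklore] -/
@[simp] theorem vecField_apply {P : Type*} (S : P → κ → ℝ) (p : P) (K : κ) :
    vecField S p K = S p K := rfl

variable {P : Type*} [NormedAddCommGroup P] [NormedSpace ℝ P] {S : P → κ → ℝ} {U : Set P} {p : P}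

/-- The component field is smooth where all components are. [folklore] -/
theorem contDiffOn_vecField (hS : ∀ K, ContDiffOn ℝ ∞ (fun q ↦ S q K) U) :
    ContDiffOn ℝ ∞ (vecField S) U :=
  (toEuc κ).contDiff.comp_contDiffOn (contDiffOn_pi.2 hS)

/-- **Components of the derivative are derivatives of the components**:
`(D(vecField S)(p) v)_K = ∂_v S_K(p)`. [folklore] -/
theorem fderiv_vecField_apply (hU : IsOpen U) (hS : ∀ K, ContDiffOn ℝ ∞ (fun q ↦ S q K) U)
    (hp : p ∈ U) (v : P) (K : κ) :
    fderiv ℝ (vecField S) p v K = fderiv ℝ (fun q ↦ S q K) p v := by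
  have hd : DifferentiableAt ℝ (vecField S) p :=
    ((contDiffOn_vecField hS).contDiffAt (hU.mem_nhds hp)).differentiableAt (by simp)
  have h1 := (EuclideanSpace.proj (𝕜 := ℝ) K).hasFDerivAt.comp p hd.hasFDerivAt
  have h2 : (⇑(EuclideanSpace.proj (𝕜 := ℝ) K) ∘ vecField S) = fun q ↦ S q K := by
    funext q; simp [vecField]
  rw [h2] at h1
  rw [h1.fderiv]
  simp

/-- The derivative of the component field along a fixed vector is again a component field (of the
derivatives of the components), on the open set. [folklore] -/
theorem fderiv_vecField_eq (hU : IsOpen U) (hS : ∀ K, ContDiffOn ℝ ∞ (fun q ↦ S q K) U)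
    (hp : p ∈ U) (v : P) :
    fderiv ℝ (vecField S) p v = vecField (fun q K ↦ fderiv ℝ (fun q' ↦ S q' K) q v) p := by
  ext K
  rw [fderiv_vecField_apply hU hS hp, vecField_apply]

omit [Fintype κ] in
/-- Directional derivatives of smooth components are smooth. [folklore] -/
theorem contDiffOn_fderiv_comp (hU : IsOpen U) (hS : ∀ K, ContDiffOn ℝ ∞ (fun q ↦ S q K) U) (v : P)
    (K : κ) : ContDiffOn ℝ ∞ (fun q ↦ fderiv ℝ (fun q' ↦ S q' K) q v) U :=
  ((hS K).fderiv_of_isOpen hU (by simp)).clm_apply contDiffOn_const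

/-- **Components of second derivatives**: `(∂_w (q ↦ D(vecField S)(q) v))(p)_K = D²S_K(p)(w)(v)`.
[folklore] -/
theorem fderiv_fderiv_vecField_apply (hU : IsOpen U) (hS : ∀ K, ContDiffOn ℝ ∞ (fun q ↦ S q K) U)
    (hp : p ∈ U) (v w : P) (K : κ) :
    fderiv ℝ (fun q ↦ fderiv ℝ (vecField S) q v) p w K =
      fderiv ℝ (fderiv ℝ (fun q ↦ S q K)) p w v := by
  have heq : (fun q ↦ fderiv ℝ (vecField S) q v) =ᶠ[𝓝 p]
      vecField (fun q K ↦ fderiv ℝ (fun q' ↦ S q' K) q v) :=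
    Filter.eventually_of_mem (hU.mem_nhds hp) fun q hq ↦ fderiv_vecField_eq hU hS hq v
  rw [heq.fderiv_eq, fderiv_vecField_apply hU (contDiffOn_fderiv_comp hU hS v) hp]
  have hd : DifferentiableAt ℝ (fderiv ℝ (fun q ↦ S q K)) p :=
    ((((hS K).fderiv_of_isOpen (m := ∞) hU (by simp)) p hp).contDiffAt (hU.mem_nhds hp)).differentiableAt
      (by simp)
  exact fderiv_clm_apply_const hd v w

/-- **The wave operator on the component field, componentwise**:
`(P (vecField S))_K = 𝔞 ∂_t∂_t S_K − 2 Σ 𝔟ⁱ ∂_i∂_t S_K − Σ 𝔊ⁱʲ ∂_i∂_j S_K`. [folklore] -/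
theorem op_vecField_apply {S : Pt d → κ → ℝ} {U : Set (Pt d)} (hU : IsOpen U)
    (hS : ∀ K, ContDiffOn ℝ ∞ (fun q ↦ S q K) U) {p : Pt d} (hp : p ∈ U) (a : Pt d → ℝ)
    (b : Fin d → Pt d → ℝ) (Gc : Fin d → Fin d → Pt d → ℝ) (K : κ) :
    op (vecField S) a b Gc p K =
      a p * fderiv ℝ (fderiv ℝ (fun q ↦ S q K)) p eT eT
        - 2 * ∑ i, b i p * fderiv ℝ (fderiv ℝ (fun q ↦ S q K)) p (eX i) eT
        - ∑ i, ∑ j, Gc i j p * fderiv ℝ (fderiv ℝ (fun q ↦ S q K)) p (eX i) (eX j) := by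
  have h2 : ∀ v w, fderiv ℝ (fun q ↦ fderiv ℝ (vecField S) q v) p w K =
      fderiv ℝ (fderiv ℝ (fun q ↦ S q K)) p w v := fun v w ↦ fderiv_fderiv_vecField_apply hU hS hp v w K
  unfold op dTT dTX dXX dT dX
  simp [h2]

/-- The time derivative of the component field, componentwise. [folklore] -/
theorem dT_vecField_apply {S : Pt d → κ → ℝ} {U : Set (Pt d)} (hU : IsOpen U)
    (hS : ∀ K, ContDiffOn ℝ ∞ (fun q ↦ S q K) U) {p : Pt d} (hp : p ∈ U) (K : κ) :
    dT (vecField S) p K = fderiv ℝ (fun q ↦ S q K) p eT :=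
  fderiv_vecField_apply hU hS hp eT K

/-- The spatial derivatives of the component field, componentwise. [folklore] -/
theorem dX_vecField_apply {S : Pt d → κ → ℝ} {U : Set (Pt d)} (hU : IsOpen U)
    (hS : ∀ K, ContDiffOn ℝ ∞ (fun q ↦ S q K) U) {p : Pt d} (hp : p ∈ U) (i : Fin d) (K : κ) :
    dX (vecField S) i p K = fderiv ℝ (fun q ↦ S q K) p (eX i) :=
  fderiv_vecField_apply hU hS hp (eX i) K

omit [Fintype κ] in
/-- The jets of the zero field vanish. [folklore] -/
theorem dT_zero [Fintype κ] (p : Pt d) : dT (0 : Pt d → EuclideanSpace ℝ κ) p = 0 := by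
  simp [dT]

omit [Fintype κ] in
/-- The jets of the zero field vanish. [folklore] -/
theorem dX_zero [Fintype κ] (i : Fin d) (p : Pt d) : dX (0 : Pt d → EuclideanSpace ℝ κ) i p = 0 := by
  simp [dX]

omit [Fintype κ] in
/-- The wave operator annihilates the zero field. [folklore] -/
theorem op_zero [Fintype κ] (a : Pt d → ℝ) (b : Fin d → Pt d → ℝ) (Gc : Fin d → Fin d → Pt d → ℝ)
    (p : Pt d) : op (0 : Pt d → EuclideanSpace ℝ κ) a b Gc p = 0 := by
  have h1 : dT (0 : Pt d → EuclideanSpace ℝ κ) = 0 := funext fun q ↦ dT_zero q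
  have h2 : ∀ j, dX (0 : Pt d → EuclideanSpace ℝ κ) j = 0 := fun j ↦ funext fun q ↦ dX_zero j q
  simp [op, dTT, dTX, dXX, h1, h2]

end VecField

/-! ### Uniqueness near a slice point -/

section Uniqueness

variable {α : Type*} [Fintype α] [DecidableEq α] {G : Pt d → Pt d →L[ℝ] Pt d →L[ℝ] ℝ}
  {T : Set (Pt d)}

/-- The jet variables `(q, U, U_t, (U_i)_i)` of the first-order uniqueness theorem
`VarWave.eventually_eq_of_quasilinear_germ`. [folklore] -/
abbrev JetPt (d : ℕ) (κ : Type*) : Type _ :=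
  Pt d × EuclideanSpace ℝ κ × EuclideanSpace ℝ κ × (Fin d → EuclideanSpace ℝ κ)

/-- The value jet `U` as a function `κ → ℝ`. [folklore] -/
def jetU {κ : Type*} (q : JetPt d κ) : κ → ℝ := fun K ↦ q.2.1 K

/-- The derivative jets `(U_t, U_i)` indexed by `Option (Fin d)` (`none ↦ ∂_t`). [folklore] -/
def jetP {κ : Type*} (q : JetPt d κ) : Option (Fin d) → κ → ℝ :=
  fun m K ↦ Option.elim m (q.2.2.1 K) (fun i ↦ q.2.2.2 i K)

omit [Fintype α] [DecidableEq α] in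
/-- Unfolding lemma. [folklore] -/
@[simp] theorem jetU_apply (q : JetPt d α) (K : α) : jetU q K = q.2.1 K := rfl

omit [Fintype α] [DecidableEq α] in
/-- Unfolding lemma. [folklore] -/
@[simp] theorem jetP_none (q : JetPt d α) (K : α) : jetP q none K = q.2.2.1 K := rfl

omit [Fintype α] [DecidableEq α] in
/-- Unfolding lemma. [folklore] -/
@[simp] theorem jetP_some (q : JetPt d α) (i : Fin d) (K : α) : jetP q (some i) K = q.2.2.2 i K := rfl

omit [DecidableEq α] in
/-- The value jet is smooth (linear). [folklore] -/
theorem contDiff_jetU : ContDiff ℝ ∞ (jetU : JetPt d α → α → ℝ) := by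
  refine contDiff_pi.2 fun K ↦ ?_
  show ContDiff ℝ ∞ fun q : JetPt d α ↦ q.2.1 K
  exact (EuclideanSpace.proj (𝕜 := ℝ) K).contDiff.comp (contDiff_fst.comp contDiff_snd)

omit [DecidableEq α] in
/-- The derivative jets are smooth (linear). [folklore] -/
theorem contDiff_jetP : ContDiff ℝ ∞ (jetP : JetPt d α → Option (Fin d) → α → ℝ) := by
  refine contDiff_pi.2 fun m ↦ contDiff_pi.2 fun K ↦ ?_
  rcases m with _ | i
  · show ContDiff ℝ ∞ fun q : JetPt d α ↦ q.2.2.1 K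
    exact (EuclideanSpace.proj (𝕜 := ℝ) K).contDiff.comp
      (contDiff_fst.comp (contDiff_snd.comp contDiff_snd))
  · show ContDiff ℝ ∞ fun q : JetPt d α ↦ q.2.2.2 i K
    exact (EuclideanSpace.proj (𝕜 := ℝ) K).contDiff.comp ((contDiff_apply ℝ _ i).comp
      (contDiff_snd.comp (contDiff_snd.comp contDiff_snd)))

/-- **The right-hand side of the first-order form of `□S = L·S`**: the lower-order part of `□` on
the jets minus `L·U`. [cite: John1982, Ch. 5 §3] -/
def rhsN (G : Pt d → Pt d →L[ℝ] Pt d →L[ℝ] ℝ)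
    (L : Pt d → (α → Option (Fin d)) → (α → Option (Fin d)) → ℝ)
    (q : JetPt d (α → Option (Fin d))) : EuclideanSpace ℝ (α → Option (Fin d)) :=
  toEuc _ (fun I ↦ tlapLower G (waveBasis d) q.1 (jetU q) (jetP q) I - ∑ J, L q.1 I J * q.2.1 J)

/-- Components of `rhsN`. [folklore] -/
@[simp] theorem rhsN_apply (G : Pt d → Pt d →L[ℝ] Pt d →L[ℝ] ℝ)
    (L : Pt d → (α → Option (Fin d)) → (α → Option (Fin d)) → ℝ)
    (q : JetPt d (α → Option (Fin d))) (I : α → Option (Fin d)) :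
    rhsN G L q I = tlapLower G (waveBasis d) q.1 (jetU q) (jetP q) I - ∑ J, L q.1 I J * q.2.1 J := by
  simp [rhsN]

/-- `rhsN` is smooth on `T × (jets)`. [folklore] -/
theorem IsMetricOn.contDiffOn_rhsN (hG : IsMetricOn G T)
    {L : Pt d → (α → Option (Fin d)) → (α → Option (Fin d)) → ℝ}
    (hL : ∀ I J, ContDiffOn ℝ ∞ (fun p ↦ L p I J) T) :
    ContDiffOn ℝ ∞ (rhsN G L) (T ×ˢ (univ : Set (EuclideanSpace ℝ (α → Option (Fin d)) ×
      EuclideanSpace ℝ (α → Option (Fin d)) × (Fin d → EuclideanSpace ℝ (α → Option (Fin d)))))) := by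
  have h1 : ContDiff ℝ ∞ (jetU : JetPt d (α → Option (Fin d)) → (α → Option (Fin d)) → ℝ) :=
    contDiff_jetU
  have h2 : ContDiff ℝ ∞
      (jetP : JetPt d (α → Option (Fin d)) → Option (Fin d) → (α → Option (Fin d)) → ℝ) :=
    contDiff_jetP
  have hmap : ContDiff ℝ ∞ fun q : JetPt d (α → Option (Fin d)) ↦
      ((q.1, (jetU q, jetP q)) : Pt d × LapJet (Option (Fin d)) α) :=
    contDiff_fst.prodMk (h1.prodMk h2)
  have hto : MapsTo (fun q : JetPt d (α → Option (Fin d)) ↦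
      ((q.1, (jetU q, jetP q)) : Pt d × LapJet (Option (Fin d)) α)) (T ×ˢ univ) (T ×ˢ univ) :=
    fun q hq ↦ mk_mem_prod (mem_prod.1 hq).1 (mem_univ _)
  have hcomp : ∀ I, ContDiffOn ℝ ∞ (fun q : JetPt d (α → Option (Fin d)) ↦
      tlapLower G (waveBasis d) q.1 (jetU q) (jetP q) I - ∑ J, L q.1 I J * q.2.1 J) (T ×ˢ univ) := by
    intro I
    refine ContDiffOn.sub ?_ ?_
    · have hc := hG.contDiffOn_tlapLower (b := waveBasis d) (α := α) I
      have h3 := ContDiffOn.comp hc (hmap.contDiffOn (s := T ×ˢ univ)) hto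
      exact h3
    · refine ContDiffOn.sum fun J _ ↦ ContDiffOn.mul ?_ ?_
      · exact (hL I J).comp contDiffOn_fst fun q hq ↦ (mem_prod.1 hq).1
      · exact ((EuclideanSpace.proj (𝕜 := ℝ) J).contDiff.comp
          (contDiff_fst.comp contDiff_snd)).contDiffOn
  have hpi : ContDiffOn ℝ ∞ (fun q : JetPt d (α → Option (Fin d)) ↦ fun I ↦
      tlapLower G (waveBasis d) q.1 (jetU q) (jetP q) I - ∑ J, L q.1 I J * q.2.1 J) (T ×ˢ univ) :=
    contDiffOn_pi.2 hcomp
  unfold rhsN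
  exact (toEuc (α → Option (Fin d))).contDiff.comp_contDiffOn hpi

/-- **Uniqueness near a slice point for linear tensor wave equations.** Let `G` be smooth,
symmetric and nondegenerate on the open set `T ∋ (0, x₁)`, hyperbolic at `(0, x₁)` with respect to
the slices `{t = const}` (`g⁰⁰(0,x₁) < 0`, `(gⁱʲ(0,x₁)) ≥ λ > 0`). If a smooth tensor field `S` on
`T` solves `(□S)_I = Σ_J L_{IJ} S_J` on `T` with smooth `L`, and `S = ∂_t S = 0` on the slice
`{t = 0}` near `x₁`, then `S = 0` near `(0, x₁)` (Hawking–Ellis 1973, Prop. 7.4.5; John 1982,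
Ch. 5 §3; the uniqueness step of Fischer–Marsden–Moncrief 1980, Lemma 2.2).
[cite: HawkingEllis1973CUP, §7.4, Prop. 7.4.5] [cite: John1982, Ch. 5 §3] -/
theorem IsMetricOn.eventually_eq_zero_of_tlap_eq (hG : IsMetricOn G T) {x₁ : EuclideanSpace ℝ (Fin d)}
    (hx₁ : ((0 : ℝ), x₁) ∈ T)
    (ha : ginv G (waveBasis d) ((0 : ℝ), x₁) none none < 0) {lam : ℝ} (hlam : 0 < lam)
    (hpos : ∀ ξ : Fin d → ℝ, lam * ∑ i, ξ i ^ 2 ≤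
      ∑ i, ∑ j, ginv G (waveBasis d) ((0 : ℝ), x₁) (some i) (some j) * (ξ i * ξ j))
    {S : Pt d → (α → Option (Fin d)) → ℝ} (hS : TSmoothOn S T)
    {L : Pt d → (α → Option (Fin d)) → (α → Option (Fin d)) → ℝ}
    (hL : ∀ I J, ContDiffOn ℝ ∞ (fun p ↦ L p I J) T)
    (heq : ∀ p ∈ T, ∀ I, tlap G (waveBasis d) S p I = ∑ J, L p I J * S p J)
    (h0 : ∀ᶠ y in 𝓝 x₁, ∀ I, S ((0 : ℝ), y) I = 0)
    (h1 : ∀ᶠ y in 𝓝 x₁, ∀ I, fderiv ℝ (fun p ↦ S p I) ((0 : ℝ), y) eT = 0) :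
    ∀ᶠ p in 𝓝 (((0 : ℝ), x₁) : Pt d), ∀ I, S p I = 0 := by
  have hT := hG.isOpen
  set bE := waveBasis d with hbE
  -- the unknown: all components, `ℝ^κ`-valued, `κ = (α → Option (Fin d))`
  set u₁ : Pt d → EuclideanSpace ℝ (α → Option (Fin d)) := vecField S with hu₁
  have hSK : ∀ K, ContDiffOn ℝ ∞ (fun q ↦ S q K) T := fun K ↦ hS K
  -- the coefficients (symmetrised spatial block) and the right-hand side on the jet spaces
  set 𝔞 : Pt d × EuclideanSpace ℝ (α → Option (Fin d)) → ℝ := fun q ↦ -ginv G bE q.1 none none with h𝔞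
  set 𝔟 : Fin d → Pt d × EuclideanSpace ℝ (α → Option (Fin d)) → ℝ :=
    fun i q ↦ ginv G bE q.1 none (some i) with h𝔟
  set 𝔊 : Fin d → Fin d → Pt d × EuclideanSpace ℝ (α → Option (Fin d)) → ℝ :=
    fun i j q ↦ 2⁻¹ * (ginv G bE q.1 (some i) (some j) + ginv G bE q.1 (some j) (some i)) with h𝔊
  set 𝔑 := rhsN G L with h𝔑
  -- openness and smoothness
  have hΩ₁ : IsOpen (T ×ˢ (univ : Set (EuclideanSpace ℝ (α → Option (Fin d))))) := hT.prod isOpen_univ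
  have hΩ₂ : IsOpen (T ×ˢ (univ : Set (EuclideanSpace ℝ (α → Option (Fin d)) ×
      EuclideanSpace ℝ (α → Option (Fin d)) × (Fin d → EuclideanSpace ℝ (α → Option (Fin d)))))) :=
    hT.prod isOpen_univ
  have hginv₁ : ∀ i j, ContDiffOn ℝ ∞ (fun q : Pt d × EuclideanSpace ℝ (α → Option (Fin d)) ↦
      ginv G bE q.1 i j) (T ×ˢ univ) := fun i j ↦
    (hG.contDiffOn_ginv bE i j).comp contDiffOn_fst fun q hq ↦ (mem_prod.1 hq).1
  have h𝔞s : ContDiffOn ℝ ∞ 𝔞 (T ×ˢ univ) := (hginv₁ none none).neg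
  have h𝔟s : ∀ i, ContDiffOn ℝ ∞ (𝔟 i) (T ×ˢ univ) := fun i ↦ hginv₁ none (some i)
  have h𝔊s : ∀ i j, ContDiffOn ℝ ∞ (𝔊 i j) (T ×ˢ univ) := fun i j ↦
    contDiffOn_const.mul ((hginv₁ _ _).add (hginv₁ _ _))
  have h𝔊sym : ∀ i j q, 𝔊 i j q = 𝔊 j i q := fun i j q ↦ by simp only [h𝔊]; ring
  have h𝔑s := hG.contDiffOn_rhsN hL
  -- the solutions
  have hu₁s : ContDiffOn ℝ ∞ u₁ T := contDiffOn_vecField hSK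
  have hu₂s : ContDiffOn ℝ ∞ (0 : Pt d → EuclideanSpace ℝ (α → Option (Fin d))) T := contDiffOn_const
  -- hyperbolicity at the base point
  have hapos : 0 < 𝔞 (((0 : ℝ), x₁), u₁ (0, x₁)) := by simp only [h𝔞]; linarith
  have hGpos : ∀ X : Fin d → EuclideanSpace ℝ (α → Option (Fin d)),
      lam * ∑ i, ‖X i‖ ^ 2 ≤ ∑ i, ∑ j, 𝔊 i j (((0 : ℝ), x₁), u₁ (0, x₁)) * ⟪X i, X j⟫ := by
    refine sum_sum_mul_inner_ge fun ξ ↦ ?_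
    have hsym : ∑ i, ∑ j, 𝔊 i j (((0 : ℝ), x₁), u₁ (0, x₁)) * (ξ i * ξ j) =
        ∑ i, ∑ j, ginv G bE ((0 : ℝ), x₁) (some i) (some j) * (ξ i * ξ j) := by
      have hsw : ∑ i, ∑ j, ginv G bE ((0 : ℝ), x₁) (some j) (some i) * (ξ i * ξ j) =
          ∑ i, ∑ j, ginv G bE ((0 : ℝ), x₁) (some i) (some j) * (ξ i * ξ j) := by
        rw [Finset.sum_comm]
        exact Finset.sum_congr rfl fun i _ ↦ Finset.sum_congr rfl fun j _ ↦ by ring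
      simp only [h𝔊, mul_add, add_mul, Finset.sum_add_distrib]
      have e1 : ∑ i, ∑ j, 2⁻¹ * ginv G bE ((0 : ℝ), x₁) (some i) (some j) * (ξ i * ξ j) =
          2⁻¹ * ∑ i, ∑ j, ginv G bE ((0 : ℝ), x₁) (some i) (some j) * (ξ i * ξ j) := by
        rw [Finset.mul_sum]; refine Finset.sum_congr rfl fun i _ ↦ ?_
        rw [Finset.mul_sum]; exact Finset.sum_congr rfl fun j _ ↦ by ring
      have e2 : ∑ i, ∑ j, 2⁻¹ * ginv G bE ((0 : ℝ), x₁) (some j) (some i) * (ξ i * ξ j) =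
          2⁻¹ * ∑ i, ∑ j, ginv G bE ((0 : ℝ), x₁) (some j) (some i) * (ξ i * ξ j) := by
        rw [Finset.mul_sum]; refine Finset.sum_congr rfl fun i _ ↦ ?_
        rw [Finset.mul_sum]; exact Finset.sum_congr rfl fun j _ ↦ by ring
      rw [e1, e2, hsw]
      ring
    rw [hsym]
    exact hpos ξ
  -- the equation for `u₁`
  have h₁ : ∀ᶠ p in 𝓝 (((0 : ℝ), x₁) : Pt d),
      op u₁ (fun q ↦ 𝔞 (q, u₁ q)) (fun i q ↦ 𝔟 i (q, u₁ q)) (fun i j q ↦ 𝔊 i j (q, u₁ q)) p =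
        𝔑 (p, u₁ p, dT u₁ p, fun i ↦ dX u₁ i p) := by
    filter_upwards [hT.mem_nhds hx₁] with p hp
    have hi := hG.isInvertible p hp
    have hs := hG.symm p hp
    have hgs : ∀ a c, ginv G bE p a c = ginv G bE p c a := fun a c ↦ ginv_comm bE hi hs a c
    -- the jets of `u₁` at `p`
    have hjU : jetU ((p, u₁ p, dT u₁ p, fun i ↦ dX u₁ i p) : JetPt d (α → Option (Fin d))) = S p := by
      funext K; simp [jetU, hu₁]
    have hjP : jetP ((p, u₁ p, dT u₁ p, fun i ↦ dX u₁ i p) : JetPt d (α → Option (Fin d))) =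
        fun m J ↦ fderiv ℝ (fun q ↦ S q J) p (bE m) := by
      funext m J
      rcases m with _ | i
      · simp only [jetP_none, hu₁, dT_vecField_apply hT hSK hp, hbE, waveBasis_none]
      · simp only [jetP_some, hu₁, dX_vecField_apply hT hSK hp, hbE, waveBasis_some]
    ext K
    -- the right-hand side: `tlapLower − L·S = −(principal part)`
    have hR : 𝔑 (p, u₁ p, dT u₁ p, fun i ↦ dX u₁ i p) K =
        -∑ j, ∑ k, ginv G bE p j k * fderiv ℝ (fderiv ℝ (fun q ↦ S q K)) p (bE j) (bE k) := by
      rw [h𝔑, rhsN_apply, hjU, hjP]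
      have hu : u₁ p = vecField S p := rfl
      simp only [hu, vecField_apply, hbE]
      have := hG.tlap_eq_principal_add_lower (b := bE) hS hp K
      rw [heq p hp K, hbE] at this
      linarith
    rw [hR, op_vecField_apply hT hSK hp]
    -- the left-hand side: expand the principal part over `Option (Fin d)`
    have hD2 : ∀ v w, fderiv ℝ (fderiv ℝ (fun q ↦ S q K)) p v w = fderiv ℝ (fderiv ℝ (fun q ↦ S q K)) p w v :=
      fun v w ↦ ((hS K p hp).contDiffAt (hT.mem_nhds hp)).isSymmSndFDerivAt two_le_infty v w
    rw [Fintype.sum_option]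
    simp only [Fintype.sum_option, hbE, waveBasis_none, waveBasis_some, h𝔞, h𝔟, h𝔊]
    rw [Finset.sum_add_distrib]
    have e3 : ∑ i, ginv G (waveBasis d) p (some i) none *
        fderiv ℝ (fderiv ℝ (fun q ↦ S q K)) p (eX i) eT =
        ∑ i, ginv G (waveBasis d) p none (some i) * fderiv ℝ (fderiv ℝ (fun q ↦ S q K)) p (eX i) eT :=
      Finset.sum_congr rfl fun i _ ↦ by rw [hgs]
    have e4 : ∑ i, ginv G (waveBasis d) p none (some i) *
        fderiv ℝ (fderiv ℝ (fun q ↦ S q K)) p eT (eX i) =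
        ∑ i, ginv G (waveBasis d) p none (some i) * fderiv ℝ (fderiv ℝ (fun q ↦ S q K)) p (eX i) eT :=
      Finset.sum_congr rfl fun i _ ↦ by rw [hD2]
    have e5 : ∑ i, ∑ j, 2⁻¹ * (ginv G (waveBasis d) p (some i) (some j) +
        ginv G (waveBasis d) p (some j) (some i)) * fderiv ℝ (fderiv ℝ (fun q ↦ S q K)) p (eX i) (eX j) =
        ∑ i, ∑ j, ginv G (waveBasis d) p (some i) (some j) *
          fderiv ℝ (fderiv ℝ (fun q ↦ S q K)) p (eX i) (eX j) :=
      Finset.sum_congr rfl fun i _ ↦ Finset.sum_congr rfl fun j _ ↦ by rw [hgs (some j) (some i)]; ring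
    rw [e3, e4, e5]
    ring
  -- the equation for `u₂ = 0`
  have h₂ : ∀ᶠ p in 𝓝 (((0 : ℝ), x₁) : Pt d),
      op (0 : Pt d → EuclideanSpace ℝ (α → Option (Fin d))) (fun q ↦ 𝔞 (q, (0 : Pt d → _) q))
        (fun i q ↦ 𝔟 i (q, (0 : Pt d → _) q)) (fun i j q ↦ 𝔊 i j (q, (0 : Pt d → _) q)) p =
        𝔑 (p, (0 : Pt d → EuclideanSpace ℝ (α → Option (Fin d))) p,
          dT (0 : Pt d → EuclideanSpace ℝ (α → Option (Fin d))) p,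
          fun i ↦ dX (0 : Pt d → EuclideanSpace ℝ (α → Option (Fin d))) i p) := by
    refine Filter.Eventually.of_forall fun p ↦ ?_
    rw [op_zero]
    have hjU : jetU (((p, (0 : Pt d → EuclideanSpace ℝ (α → Option (Fin d))) p,
        dT (0 : Pt d → EuclideanSpace ℝ (α → Option (Fin d))) p,
        fun i ↦ dX (0 : Pt d → EuclideanSpace ℝ (α → Option (Fin d))) i p)) :
        JetPt d (α → Option (Fin d))) = 0 := by
      funext K; simp [jetU]
    have hjP : jetP (((p, (0 : Pt d → EuclideanSpace ℝ (α → Option (Fin d))) p,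
        dT (0 : Pt d → EuclideanSpace ℝ (α → Option (Fin d))) p,
        fun i ↦ dX (0 : Pt d → EuclideanSpace ℝ (α → Option (Fin d))) i p)) :
        JetPt d (α → Option (Fin d))) = 0 := by
      funext m K
      rcases m with _ | i
      · simp [jetP, dT_zero]
      · simp [jetP, dX_zero]
    ext K
    rw [h𝔑, rhsN_apply, hjU, hjP, tlapLower_zero]
    simp
  -- the Cauchy data
  have hslice : ∀ᶠ y in 𝓝 x₁, (((0 : ℝ), y) : Pt d) ∈ T :=
    (Continuous.prodMk_right (0 : ℝ)).continuousAt.eventually_mem (hT.mem_nhds hx₁)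
  have h0' : ∀ᶠ y in 𝓝 x₁, u₁ ((0 : ℝ), y) = (0 : Pt d → EuclideanSpace ℝ (α → Option (Fin d))) (0, y) :=
    h0.mono fun y hy ↦ PiLp.ext fun K ↦ by simp [hu₁, hy K]
  have h1' : ∀ᶠ y in 𝓝 x₁, dT u₁ ((0 : ℝ), y) =
      dT (0 : Pt d → EuclideanSpace ℝ (α → Option (Fin d))) (0, y) := by
    filter_upwards [h1, hslice] with y hy hyT
    rw [dT_zero]
    exact PiLp.ext fun K ↦ by rw [hu₁, dT_vecField_apply hT hSK hyT, hy K]; rfl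
  -- uniqueness
  have hmain := eventually_eq_of_quasilinear_germ hΩ₁ hΩ₂ h𝔞s h𝔟s h𝔊s h𝔊sym h𝔑s
    (hT.mem_nhds hx₁) hu₁s hu₂s (mk_mem_prod hx₁ (mem_univ _)) (mk_mem_prod hx₁ (mem_univ _))
    hapos hlam hGpos h₁ h₂ h0' h1'
  exact hmain.mono fun p hp I ↦ by
    have := congrArg (fun v : EuclideanSpace ℝ (α → Option (Fin d)) ↦ v I) hp
    simpa [hu₁] using this

end Uniqueness

end MetricCoord

end Literature.Geometry.Lorentzian

end
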